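import Summits.ValiantsHypothesis.ValiantsHypothesis.Theorems.NewtonFramesTwoProductsFrameRungTwoTrinomialWords

/-!
# Crux `TwoProducts` (stmt-5906), line `FrameRungTwo`: the three-gap covering family (counting half of the carry residual)

The line's open stub `stub_crossCancelCount` at `k ≤ 2` is proved (g2) on parallelogram-free frames by covering every
cross-cancelling vertex with "top tuple with ≤ 1 demotion" or "top minus two gaps of one coordinate".  On CARRY frames the
vertex word can demote arbitrarily many letters (telescope frames, CALIBRATION-FrameRungTwo-g3.md §2c), and the numerically
exact structure statement (memo §3, lemma (IX)) is: the vertex is `emb Σb − (g₁ + g₂ + g₃)` for an `l'`-top tuple `b` of ONE of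
the two frames and at most three gaps `g_k = emb b_{p_k} − emb y_k` of that frame (coordinates MAY repeat) — it covers words
demoting ≤ 3 letters and "a word demoting ≤ 2 letters minus one more gap of the same frame" (the shallow-neighbour form).
This file is the COUNTING HALF, unconditional and frame-hypothesis-free:

* `card_cover3_le` — that family has `≤ (4 (m t)² + 7) · (m t + 1)³` elements (floor's `stub_topTupleCount` × optional
  (coordinate, letter) triples);
* `mem_cover3` — membership of `emb Σb − G o₁ − G o₂ − G o₃` for a key-top tuple `b` and optional (coordinate, letter) pairs `oₖ`;
* `mem_cover3_of_card_le_three` — a word demoting at most three letters of its key-top tuple lies in the family;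
* `mem_cover3_of_neighbour` — `emb Σw − (emb T_p − emb y)` lies in the family when `w` demotes at most two letters.

Honest scope: bookkeeping for ONE stub of a rung strictly below the crux `TwoProducts`; the structural lemma (IX) that would feed
it on carry frames is OPEN; nothing here bears on `VP ≠ VNP`. [ours; setting KPTT arXiv:1308.2286 §2]
-/

set_option linter.dupNamespace false

namespace Summit.ValiantsHypothesis.ValiantsHypothesis.Theorems.NewtonFramesTwoProducts.FrameRungTwoTrinomial

open MvPolynomial
open scoped BigOperators Classical
open Summit.ValiantsHypothesis.Theorems.DissociatedFixedK (lexKey lexKey_injective lexTop lexTop_mem lexKey_le_lexTop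
  stub_topTupleCount)
open Summit.ValiantsHypothesis.ValiantsHypothesis.Theorems.DissociatedFixedK.Negative (emb emb_injective)
open Summit.ValiantsHypothesis.ValiantsHypothesis.Theorems.NewtonFramesTwoProducts.FrameRungTwoBinomial
  (emb_add emb_sum eq_T_of_not_mem_filter ne_T_of_mem_filter)

noncomputable section

section Cover

variable {m : ℕ}

/-- **Size of the three-gap family.** -/
theorem card_cover3_le (t : ℕ) (f : Fin m → MvPolynomial (Fin 2) ℂ) (hS : ∀ j, ((f j).support).card ≤ t) :
    (((Fintype.piFinset fun j => (f j).support).filter fun b =>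
        ∃ l : (Fin 2 → ℝ) →L[ℝ] ℝ, ∀ j, ∀ x ∈ (f j).support, lexKey l x ≤ lexKey l (b j)).biUnion fun b =>
      (((Finset.insertNone (Finset.univ.biUnion fun j => ((f j).support).image (Prod.mk j))) ×ˢ
         (Finset.insertNone (Finset.univ.biUnion fun j => ((f j).support).image (Prod.mk j)))) ×ˢ
         (Finset.insertNone (Finset.univ.biUnion fun j => ((f j).support).image (Prod.mk j)))).image fun q =>
        emb (∑ j, b j) - Option.elim q.1.1 (0 : Fin 2 → ℝ) (fun p => emb (b p.1) - emb p.2)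
          - Option.elim q.1.2 (0 : Fin 2 → ℝ) (fun p => emb (b p.1) - emb p.2)
          - Option.elim q.2 (0 : Fin 2 → ℝ) (fun p => emb (b p.1) - emb p.2)).card
      ≤ (4 * (m * t) ^ 2 + 7) * (m * t + 1) ^ 3 := by
  have hBT : ((Fintype.piFinset fun j => (f j).support).filter fun b =>
      ∃ l : (Fin 2 → ℝ) →L[ℝ] ℝ, ∀ j, ∀ x ∈ (f j).support, lexKey l x ≤ lexKey l (b j)).card
      ≤ 4 * (m * t) ^ 2 + 7 :=
    stub_topTupleCount m t (fun j => (f j).support) hS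
  have hLET : (Finset.univ.biUnion fun j => ((f j).support).image (Prod.mk j)).card ≤ m * t := by
    calc (Finset.univ.biUnion fun j => ((f j).support).image (Prod.mk j)).card
        ≤ ∑ j, (((f j).support).image (Prod.mk j)).card := Finset.card_biUnion_le
      _ ≤ ∑ _j : Fin m, t := Finset.sum_le_sum fun j _ => Finset.card_image_le.trans (hS j)
      _ = m * t := by simp
  have hS' : (Finset.insertNone (Finset.univ.biUnion fun j => ((f j).support).image (Prod.mk j))).card ≤ m * t + 1 := by
    rw [Finset.card_insertNone]; exact Nat.add_le_add_right hLET 1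
  calc _ ≤ ∑ b ∈ ((Fintype.piFinset fun j => (f j).support).filter fun b =>
          ∃ l : (Fin 2 → ℝ) →L[ℝ] ℝ, ∀ j, ∀ x ∈ (f j).support, lexKey l x ≤ lexKey l (b j)),
          ((((Finset.insertNone (Finset.univ.biUnion fun j => ((f j).support).image (Prod.mk j))) ×ˢ
            (Finset.insertNone (Finset.univ.biUnion fun j => ((f j).support).image (Prod.mk j)))) ×ˢ
            (Finset.insertNone (Finset.univ.biUnion fun j => ((f j).support).image (Prod.mk j)))).image fun q =>
              emb (∑ j, b j) - Option.elim q.1.1 (0 : Fin 2 → ℝ) (fun p => emb (b p.1) - emb p.2)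
                - Option.elim q.1.2 (0 : Fin 2 → ℝ) (fun p => emb (b p.1) - emb p.2)
                - Option.elim q.2 (0 : Fin 2 → ℝ) (fun p => emb (b p.1) - emb p.2)).card := Finset.card_biUnion_le
    _ ≤ ∑ _b ∈ ((Fintype.piFinset fun j => (f j).support).filter fun b =>
          ∃ l : (Fin 2 → ℝ) →L[ℝ] ℝ, ∀ j, ∀ x ∈ (f j).support, lexKey l x ≤ lexKey l (b j)), (m * t + 1) ^ 3 := by
        refine Finset.sum_le_sum fun b _ => Finset.card_image_le.trans ?_
        rw [Finset.card_product, Finset.card_product]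
        calc _ ≤ (m * t + 1) * (m * t + 1) * (m * t + 1) :=
              Nat.mul_le_mul (Nat.mul_le_mul hS' hS') hS'
          _ = (m * t + 1) ^ 3 := by ring
    _ = ((Fintype.piFinset fun j => (f j).support).filter fun b =>
          ∃ l : (Fin 2 → ℝ) →L[ℝ] ℝ, ∀ j, ∀ x ∈ (f j).support, lexKey l x ≤ lexKey l (b j)).card * (m * t + 1) ^ 3 := by
        rw [Finset.sum_const, smul_eq_mul]
    _ ≤ (4 * (m * t) ^ 2 + 7) * (m * t + 1) ^ 3 := Nat.mul_le_mul_right _ hBT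

/-- **Membership, raw form.**  For a key-top tuple `b` (for some functional) and three optional (coordinate, letter) pairs. -/
theorem mem_cover3 (l : (Fin 2 → ℝ) →L[ℝ] ℝ) (f : Fin m → MvPolynomial (Fin 2) ℂ) (T : Fin m → (Fin 2 →₀ ℕ))
    (hT : ∀ j, T j ∈ (f j).support) (hTmax : ∀ j, ∀ x ∈ (f j).support, lexKey l x ≤ lexKey l (T j))
    (o₁ o₂ o₃ : Option (Fin m × (Fin 2 →₀ ℕ)))
    (ho₁ : ∀ p, o₁ = some p → p.2 ∈ (f p.1).support) (ho₂ : ∀ p, o₂ = some p → p.2 ∈ (f p.1).support)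
    (ho₃ : ∀ p, o₃ = some p → p.2 ∈ (f p.1).support) :
    emb (∑ j, T j) - Option.elim o₁ (0 : Fin 2 → ℝ) (fun p => emb (T p.1) - emb p.2)
        - Option.elim o₂ (0 : Fin 2 → ℝ) (fun p => emb (T p.1) - emb p.2)
        - Option.elim o₃ (0 : Fin 2 → ℝ) (fun p => emb (T p.1) - emb p.2) ∈
      ((Fintype.piFinset fun j => (f j).support).filter fun b =>
        ∃ l : (Fin 2 → ℝ) →L[ℝ] ℝ, ∀ j, ∀ x ∈ (f j).support, lexKey l x ≤ lexKey l (b j)).biUnion fun b =>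
      (((Finset.insertNone (Finset.univ.biUnion fun j => ((f j).support).image (Prod.mk j))) ×ˢ
         (Finset.insertNone (Finset.univ.biUnion fun j => ((f j).support).image (Prod.mk j)))) ×ˢ
         (Finset.insertNone (Finset.univ.biUnion fun j => ((f j).support).image (Prod.mk j)))).image fun q =>
        emb (∑ j, b j) - Option.elim q.1.1 (0 : Fin 2 → ℝ) (fun p => emb (b p.1) - emb p.2)
          - Option.elim q.1.2 (0 : Fin 2 → ℝ) (fun p => emb (b p.1) - emb p.2)
          - Option.elim q.2 (0 : Fin 2 → ℝ) (fun p => emb (b p.1) - emb p.2) := by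
  have hb : T ∈ (Fintype.piFinset fun j => (f j).support).filter fun b =>
      ∃ l : (Fin 2 → ℝ) →L[ℝ] ℝ, ∀ j, ∀ x ∈ (f j).support, lexKey l x ≤ lexKey l (b j) :=
    Finset.mem_filter.2 ⟨Fintype.mem_piFinset.2 hT, l, hTmax⟩
  have hmemS : ∀ o : Option (Fin m × (Fin 2 →₀ ℕ)), (∀ p, o = some p → p.2 ∈ (f p.1).support) →
      o ∈ Finset.insertNone (Finset.univ.biUnion fun j => ((f j).support).image (Prod.mk j)) := by
    intro o ho
    cases o with
    | none => exact Finset.none_mem_insertNone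
    | some p =>
      rw [Finset.some_mem_insertNone]
      exact Finset.mem_biUnion.2 ⟨p.1, Finset.mem_univ _, Finset.mem_image.2 ⟨p.2, ho p rfl, rfl⟩⟩
  refine Finset.mem_biUnion.2 ⟨T, hb, Finset.mem_image.2 ⟨((o₁, o₂), o₃), ?_, rfl⟩⟩
  exact Finset.mem_product.2 ⟨Finset.mem_product.2 ⟨hmemS o₁ ho₁, hmemS o₂ ho₂⟩, hmemS o₃ ho₃⟩

/-- The sum of the gaps of a word over a set of at most two demoted coordinates is a sum of two optional gaps. -/
theorem sum_gaps_two (f : Fin m → MvPolynomial (Fin 2) ℂ) (T a : Fin m → (Fin 2 →₀ ℕ)) (ha : ∀ j, a j ∈ (f j).support)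
    (D : Finset (Fin m)) (hD : D.card ≤ 2) :
    ∃ o₁ o₂ : Option (Fin m × (Fin 2 →₀ ℕ)), (∀ p, o₁ = some p → p.2 ∈ (f p.1).support) ∧
      (∀ p, o₂ = some p → p.2 ∈ (f p.1).support) ∧
      ∑ j ∈ D, (emb (T j) - emb (a j)) = Option.elim o₁ (0 : Fin 2 → ℝ) (fun p => emb (T p.1) - emb p.2)
        + Option.elim o₂ (0 : Fin 2 → ℝ) (fun p => emb (T p.1) - emb p.2) := by
  have hsome : ∀ j, ∀ p, some (j, a j) = some p → p.2 ∈ (f p.1).support := by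
    intro j p hp; cases hp; exact ha j
  interval_cases hD' : D.card
  · refine ⟨none, none, (fun p hp => by cases hp), (fun p hp => by cases hp), ?_⟩
    rw [Finset.card_eq_zero.1 hD']; simp
  · obtain ⟨j, rfl⟩ := Finset.card_eq_one.1 hD'
    refine ⟨some (j, a j), none, hsome j, (fun p hp => by cases hp), ?_⟩
    simp
  · obtain ⟨j₁, j₂, hne, rfl⟩ := Finset.card_eq_two.1 hD'
    refine ⟨some (j₁, a j₁), some (j₂, a j₂), hsome j₁, hsome j₂, ?_⟩
    rw [Finset.sum_pair hne]; simp

/-- **Words demoting at most three letters lie in the three-gap family** (w.r.t. their key-top tuple). -/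
theorem mem_cover3_of_card_le_three (l : (Fin 2 → ℝ) →L[ℝ] ℝ) (f : Fin m → MvPolynomial (Fin 2) ℂ)
    (T : Fin m → (Fin 2 →₀ ℕ)) (hT : ∀ j, T j ∈ (f j).support)
    (hTmax : ∀ j, ∀ x ∈ (f j).support, lexKey l x ≤ lexKey l (T j))
    (a : Fin m → (Fin 2 →₀ ℕ)) (ha : ∀ j, a j ∈ (f j).support)
    (hcard : (Finset.univ.filter fun i => a i ≠ T i).card ≤ 3) :
    emb (∑ j, a j) ∈
      ((Fintype.piFinset fun j => (f j).support).filter fun b =>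
        ∃ l : (Fin 2 → ℝ) →L[ℝ] ℝ, ∀ j, ∀ x ∈ (f j).support, lexKey l x ≤ lexKey l (b j)).biUnion fun b =>
      (((Finset.insertNone (Finset.univ.biUnion fun j => ((f j).support).image (Prod.mk j))) ×ˢ
         (Finset.insertNone (Finset.univ.biUnion fun j => ((f j).support).image (Prod.mk j)))) ×ˢ
         (Finset.insertNone (Finset.univ.biUnion fun j => ((f j).support).image (Prod.mk j)))).image fun q =>
        emb (∑ j, b j) - Option.elim q.1.1 (0 : Fin 2 → ℝ) (fun p => emb (b p.1) - emb p.2)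
          - Option.elim q.1.2 (0 : Fin 2 → ℝ) (fun p => emb (b p.1) - emb p.2)
          - Option.elim q.2 (0 : Fin 2 → ℝ) (fun p => emb (b p.1) - emb p.2) := by
  set D := Finset.univ.filter fun i => a i ≠ T i with hD
  have hsum : emb (∑ j, a j) = emb (∑ j, T j) - ∑ j ∈ D, (emb (T j) - emb (a j)) := by
    rw [emb_sum_eq T a, sum_gap_eq_sum_filter T a]
  -- split off one element if `D.card = 3`
  by_cases h3 : D.card ≤ 2
  · obtain ⟨o₁, o₂, ho₁, ho₂, hs⟩ := sum_gaps_two f T a ha D h3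
    have := mem_cover3 l f T hT hTmax o₁ o₂ none ho₁ ho₂ (fun p hp => by cases hp)
    rw [hsum, hs]
    convert this using 1
    simp only [Option.elim]
    abel
  · have hc3 : D.card = 3 := by omega
    obtain ⟨j₁, j₂, j₃, h12, h13, h23, hDeq⟩ := Finset.card_eq_three.1 hc3
    have hs : ∑ j ∈ D, (emb (T j) - emb (a j)) =
        (emb (T j₁) - emb (a j₁)) + (emb (T j₂) - emb (a j₂)) + (emb (T j₃) - emb (a j₃)) := by
      rw [hDeq, Finset.sum_insert (by simp [h12, h13]), Finset.sum_pair h23, add_assoc]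
    have hsome : ∀ j, ∀ p, some (j, a j) = some p → p.2 ∈ (f p.1).support := by
      intro j p hp; cases hp; exact ha j
    have := mem_cover3 l f T hT hTmax (some (j₁, a j₁)) (some (j₂, a j₂)) (some (j₃, a j₃)) (hsome j₁) (hsome j₂)
      (hsome j₃)
    rw [hsum, hs]
    convert this using 1
    simp only [Option.elim]
    abel

/-- **Shallow-neighbour form lies in the three-gap family**: `emb Σw − (emb T_p − emb y)` for a word `w` demoting at most two
letters and any letter `y` of coordinate `p` (the coordinate may already be demoted in `w`). -/
theorem mem_cover3_of_neighbour (l : (Fin 2 → ℝ) →L[ℝ] ℝ) (f : Fin m → MvPolynomial (Fin 2) ℂ)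
    (T : Fin m → (Fin 2 →₀ ℕ)) (hT : ∀ j, T j ∈ (f j).support)
    (hTmax : ∀ j, ∀ x ∈ (f j).support, lexKey l x ≤ lexKey l (T j))
    (w : Fin m → (Fin 2 →₀ ℕ)) (hw : ∀ j, w j ∈ (f j).support)
    (hcard : (Finset.univ.filter fun i => w i ≠ T i).card ≤ 2) (p : Fin m) (y : Fin 2 →₀ ℕ) (hy : y ∈ (f p).support) :
    emb (∑ j, w j) - (emb (T p) - emb y) ∈
      ((Fintype.piFinset fun j => (f j).support).filter fun b =>
        ∃ l : (Fin 2 → ℝ) →L[ℝ] ℝ, ∀ j, ∀ x ∈ (f j).support, lexKey l x ≤ lexKey l (b j)).biUnion fun b =>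
      (((Finset.insertNone (Finset.univ.biUnion fun j => ((f j).support).image (Prod.mk j))) ×ˢ
         (Finset.insertNone (Finset.univ.biUnion fun j => ((f j).support).image (Prod.mk j)))) ×ˢ
         (Finset.insertNone (Finset.univ.biUnion fun j => ((f j).support).image (Prod.mk j)))).image fun q =>
        emb (∑ j, b j) - Option.elim q.1.1 (0 : Fin 2 → ℝ) (fun p => emb (b p.1) - emb p.2)
          - Option.elim q.1.2 (0 : Fin 2 → ℝ) (fun p => emb (b p.1) - emb p.2)
          - Option.elim q.2 (0 : Fin 2 → ℝ) (fun p => emb (b p.1) - emb p.2) := by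
  set D := Finset.univ.filter fun i => w i ≠ T i with hD
  have hsum : emb (∑ j, w j) = emb (∑ j, T j) - ∑ j ∈ D, (emb (T j) - emb (w j)) := by
    rw [emb_sum_eq T w, sum_gap_eq_sum_filter T w]
  obtain ⟨o₁, o₂, ho₁, ho₂, hs⟩ := sum_gaps_two f T w hw D hcard
  have := mem_cover3 l f T hT hTmax o₁ o₂ (some (p, y)) ho₁ ho₂ (fun q hq => by cases hq; exact hy)
  rw [hsum, hs]
  convert this using 1
  simp only [Option.elim]
  abel

end Cover

end

end Summit.ValiantsHypothesis.ValiantsHypothesis.Theorems.NewtonFramesTwoProducts.FrameRungTwoTrinomial
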